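import Summits.AtomisticToContinuum.Crystallization.Theorems.ChartedZeroExcessLayeredLatticeLiouvilleXF

/-!
# Zero-excess layered lattice Liouville — part XG (lens-2 g59, node «SBGlueC1», second half): THE TOP-SCALE DICTIONARY — registration data bound bond AND index energies

Critic rows 1051/1119 (ORDER OF RECORD for `stmt-AtomisticToContinuum-26636`): leaf (2) `SubWindowBudgetGlueBPG` via SBGlueA–D.  Part XF gave Direction A of the energy
dictionary (index energy ⇒ bond energy, every scale) and the chart-drift transfer; this file (memo NODE-g59a §4 (C1), top scale) reads the START of the recursion
off the registration data of `IsGlobalReg`: the `IsRegistered` profile `τ` (bond domination `‖u p − u x‖ ≤ τ x`, `Σ τ² ≤ κ·nK`) bounds the bond energy of the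
displacement (XG.1) and — Direction B — the index energy of its pull-back (XG.3); XG.2 is the mass comparability of balls about atoms.  All PROVED.

* XG.1 REGISTERED PROFILES BOUND BOND ENERGIES (top scale, from `IsGlobalReg`'s `IsRegistered` data): bond domination `‖u p − u x‖ ≤ τ x` gives
  `bondEnergy Q u ≤ (10/δ+1)³·Σ_Q τ²` (`bondEnergy_le_of_dominated`, `bondEnergy_disp_le_of_isRegistered`).
* XG.2 MASS COMPARABILITY: with WK `cube_le_ncard_idxBall` and XD.5 every Euclidean ball about an atom has `≥ n³` atoms once its radius exceeds
  `(28/25)(6C₁n+8)` (`cube_le_nK_inter_ball`) — the volume lower bound the far budgets of (I4ˢ) are normalised by.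
* XG.3 ★★ DIRECTION B `idxEnergy_pullDisp_le_profile`: if `u = id − Ψ` is dominated on the bonds of a finite region `Q'` by a profile `τ ≥ 0` and `Q'` contains the
  `(28/25)(6C₁+8)`-neighbourhoods of the atoms of `idxBall X₀ n`, then `idxEnergy (pullDisp S Ψ a b w) (idxBall X₀ n) ≤ dictB C₁ δ · Σ_{Q'} τ²`: a unit index bond is
  an `S`-chain of `≤ 6C₁+8` bonds (XD.5 `exists_atom_chain`, no «`3C₁ ≤ 4`»), telescoping + Cauchy–Schwarz against the LOCAL profile mass `locProfMass` (the whole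
  `r₁`-ball, so chain multiplicities never enter), `≤ 27` unit neighbours, exchange of summation, and the packing count of atoms near a site through the injective
  atom map (`card_filter_atomOf_near_le`).  ★ `idxEnergy_pullDisp_le_of_isRegistered`: with `IsRegistered κ 4 ρ S Q' H Ψ τ` the bound is `dictB C₁ δ·κ·nK Q'` —
  the top-scale constant `C₀` of the memo's budget closing.
-/

noncomputable section

open scoped BigOperators InnerProductSpace RealInnerProductSpace
open Set Function Metric
open Summit.AtomisticToContinuum.Crystallization.Theorems.ChartedPlanarOrderRigidityDoor (E3 IsClean)
open Summit.AtomisticToContinuum.Crystallization.Theorems.ChartedPlanarOrderDensityDichotomy (μS IsSep nK)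
open Summit.AtomisticToContinuum.Crystallization.Theorems.ChartedPlanarOrderCleanScaleP (IsCleanP isCleanP_one_iff)
open Summit.AtomisticToContinuum.Crystallization.Theorems.ChartedPlanarOrderDoorLayered (Layered)

namespace Summit.AtomisticToContinuum.Crystallization.Theorems.ChartedZeroExcessLayeredLatticeLiouville

/-! ### XG.1  Registered profiles bound bond energies (the top scale) -/

/-- ★ **REGISTRATION DATA BOUND THE DISPLACEMENT'S BOND ENERGY**: `IsRegistered κ 4 ρ S Q H Ψ τ` (bond domination + profile mass `Σ τ² ≤ κ·nK Q`) gives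
`bondEnergy Q (id − Ψ) ≤ (10/δ+1)³·κ·nK Q`; with `IsGlobalReg` at scale `D ≥ R` (`κ = Cg·(D/R)·η`, `Q = win D`) this is the window budget the top scale and the
far (I4ˢ) budgets are read from. [this file, g59] -/
theorem bondEnergy_disp_le_of_isRegistered {δ κ ρ : ℝ} (hδ : 0 < δ) {S Q H : Set E3} (hsep : IsSep δ S) (hQS : Q ⊆ S) (hQ : Q.Finite) {Ψ : E3 → E3}
    {τ : E3 → ℝ} (hreg : IsRegistered κ 4 ρ S Q H Ψ τ) : bondEnergy Q (fun p => p - Ψ p) ≤ (10 / δ + 1) ^ 3 * (κ * nK Q) := by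
  obtain ⟨-, -, -, hdom, hsum, -⟩ := hreg
  have h1 := bondEnergy_le_of_dominated hδ hsep hQS hQ (φ := fun p => p - Ψ p) (τ := τ) fun x hx p hp hd => by
    have h := hdom x hx p hp hd
    rw [dist_eq_norm] at h
    have e : p - Ψ p - (x - Ψ x) = p - x - (Ψ p - Ψ x) := by abel
    rwa [e]
  exact h1.trans (mul_le_mul_of_nonneg_left hsum (by positivity))


/-! ### XG.2  Mass comparability: balls about atoms have `≥ n³` atoms -/

/-- ★ **VOLUME LOWER BOUND FOR BALLS ABOUT ATOMS**: `n³ ≤ nK (S ∩ ball (atomOf X₀) r)` whenever `r > (28/25)(6C₁n + 8)`, `n ≥ 0` (XD.5's index-side lower mass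
bound + WK `cube_le_ncard_idxBall`) — so `nK (S ∩ ball x ρ) ≥ c(C₁)·ρ³` at every atom for `ρ` beyond a fixed radius, with no density hypothesis on `S`. [this file, g59] -/
theorem cube_le_nK_inter_ball {S : Set E3} {Ψ : E3 → E3} {a b : E3} {w : ℤ → E3} {c C₁ δ : ℝ}
    (hbij : BijOn Ψ S (Layered a b w)) (hiso : IsBondIso S Ψ) (hH : IsClean (μS (Layered a b w))) (hT : IsTameIndexing C₁ a b w)
    (hc : 0 < c) (hcr : IsLayeredCrystal c a b w) (hδ : 0 < δ) (hsep : IsSep δ S) (X₀ : Cell 2 × ℤ) {n r : ℝ} (hn : 0 ≤ n)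
    (hr : 28 / 25 * (6 * C₁ * n + 8) < r) : n ^ 3 ≤ nK (S ∩ ball (atomOf S Ψ a b w X₀) r) :=
  (cube_le_ncard_idxBall X₀ hn).trans (ncard_idxBall_le_ncard_inter_ball hbij hiso hH hT hc hcr hδ hsep X₀ hr)

/-! ### XG.3  Direction B of the energy dictionary (top scale): profile domination bounds the index energy -/

section DirectionB

variable {S : Set E3} {Ψ : E3 → E3} {a b : E3} {w : ℤ → E3} {c C₁ δ : ℝ}

/-- the LOCAL PROFILE MASS about the atom at `X`: `Σ_{z ∈ Q', dist z (atomOf X) ≤ r₁} τ z²` (a filtered sum over the finite region `Q'`). [this file, g59] -/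
def locProfMass (S : Set E3) (Ψ : E3 → E3) (a b : E3) (w : ℤ → E3) {Q' : Set E3} (hQ' : Q'.Finite) (τ : E3 → ℝ) (r₁ : ℝ) (X : Cell 2 × ℤ) : ℝ :=
  ∑ z ∈ hQ'.toFinset, if dist z (atomOf S Ψ a b w X) ≤ r₁ then τ z ^ 2 else 0

/-- Auxiliary step (`locProfMass nonneg`). [formal bookkeeping] -/
theorem locProfMass_nonneg {Q' : Set E3} (hQ' : Q'.Finite) (τ : E3 → ℝ) (r₁ : ℝ) (X : Cell 2 × ℤ) : 0 ≤ locProfMass S Ψ a b w hQ' τ r₁ X :=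
  Finset.sum_nonneg fun z _ => by split_ifs <;> positivity

/-- Auxiliary step (`sq le locProfMass`): a site of the local ball contributes its `τ²`. [formal bookkeeping] -/
theorem sq_le_locProfMass {Q' : Set E3} (hQ' : Q'.Finite) (τ : E3 → ℝ) {r₁ : ℝ} {X : Cell 2 × ℤ} {z : E3} (hz : z ∈ Q')
    (hd : dist z (atomOf S Ψ a b w X) ≤ r₁) : τ z ^ 2 ≤ locProfMass S Ψ a b w hQ' τ r₁ X := by
  unfold locProfMass
  have hzF : z ∈ hQ'.toFinset := (Set.Finite.mem_toFinset hQ').2 hz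
  rw [← Finset.add_sum_erase _ _ hzF, if_pos hd]
  have h0 : 0 ≤ ∑ x ∈ hQ'.toFinset.erase z, (if dist x (atomOf S Ψ a b w X) ≤ r₁ then τ x ^ 2 else 0) :=
    Finset.sum_nonneg fun x _ => by split_ifs <;> positivity
  linarith

/-- ★ ONE UNIT INDEX BOND AGAINST THE PROFILE: if the displacement `u = id − Ψ` is dominated on the bonds of `Q'` by the profile `τ` and `Q'` contains the
`(28/25)(6C₁+8)`-neighbourhood of the atom at `X`, then for `dist X Y ≤ 1`: `‖φ Y − φ X‖² ≤ (6C₁+8)²·locProfMass X` (chain of `≤ 6C₁+8` bonds, XD.5;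
telescoping + Cauchy–Schwarz). [this file, g59] -/
theorem norm_pullDisp_sub_sq_le_locProfMass (hbij : BijOn Ψ S (Layered a b w)) (hiso : IsBondIso S Ψ) (hH : IsClean (μS (Layered a b w)))
    (hT : IsTameIndexing C₁ a b w) {Q' : Set E3} (hQ' : Q'.Finite) {τ : E3 → ℝ}
    (hdom : ∀ x ∈ Q', ∀ p ∈ Q', dist p x ≤ 4 → ‖(p - Ψ p) - (x - Ψ x)‖ ≤ τ x) (hτ : ∀ x ∈ Q', 0 ≤ τ x) {X Y : Cell 2 × ℤ} (hXY : dist X Y ≤ 1)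
    (hK : S ∩ closedBall (atomOf S Ψ a b w X) (28 / 25 * (6 * C₁ + 8)) ⊆ Q') :
    ‖pullDisp S Ψ a b w Y.1 Y.2 - pullDisp S Ψ a b w X.1 X.2‖ ^ 2 ≤ (6 * C₁ + 8) ^ 2 * locProfMass S Ψ a b w hQ' τ (28 / 25 * (6 * C₁ + 8)) X := by
  have hC : 0 ≤ C₁ := (norm_nonneg a).trans hT.1
  obtain ⟨k, z, hk, hz⟩ := exists_atom_chain hbij hiso hH hT X Y
  have hkK : (k : ℝ) ≤ 6 * C₁ + 8 := hk.trans (by nlinarith)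
  set r₁ : ℝ := 28 / 25 * (6 * C₁ + 8) with hr₁
  set u : E3 → E3 := fun p => p - Ψ p with hu
  -- chain sites lie in the local ball and in `Q'`
  have hzd : ∀ i, i ≤ k → dist (z i) (atomOf S Ψ a b w X) ≤ r₁ := fun i hi =>
    (dist_prefix_le_of_isBondChain hz hi).trans (by
      have : (i : ℝ) ≤ k := by exact_mod_cast hi
      nlinarith)
  have hzQ : ∀ i, i ≤ k → z i ∈ Q' := fun i hi => hK ⟨hz.2.2.1 i hi, mem_closedBall.2 (hzd i hi)⟩
  -- telescoping
  have htel : ‖u (z k) - u (z 0)‖ ≤ ∑ i ∈ Finset.range k, τ (z i) := by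
    have h := dist_le_range_sum_dist (fun i => u (z i)) k
    rw [dist_comm, dist_eq_norm] at h
    refine h.trans (Finset.sum_le_sum fun i hi => ?_)
    have hik : i < k := Finset.mem_range.1 hi
    rw [dist_comm, dist_eq_norm]
    exact hdom _ (hzQ i hik.le) _ (hzQ (i + 1) hik) ((hz.2.2.2 i hik).trans (by norm_num))
  have hs0 : 0 ≤ ∑ i ∈ Finset.range k, τ (z i) := Finset.sum_nonneg fun i hi => hτ _ (hzQ i (Finset.mem_range.1 hi).le)
  have hM0 := locProfMass_nonneg hQ' τ r₁ X (S := S) (Ψ := Ψ) (a := a) (b := b) (w := w)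
  have e0 : pullDisp S Ψ a b w Y.1 Y.2 - pullDisp S Ψ a b w X.1 X.2 = u (z k) - u (z 0) := by
    rw [pullDisp_eq_disp_atomOf hbij, pullDisp_eq_disp_atomOf hbij, hz.1, hz.2.1]
  rw [e0]
  calc ‖u (z k) - u (z 0)‖ ^ 2 ≤ (∑ i ∈ Finset.range k, τ (z i)) ^ 2 := pow_le_pow_left₀ (norm_nonneg _) htel 2
    _ ≤ (Finset.range k).card * ∑ i ∈ Finset.range k, τ (z i) ^ 2 := sq_sum_le_card_mul_sum_sq
    _ ≤ (k : ℝ) * ∑ i ∈ Finset.range k, locProfMass S Ψ a b w hQ' τ r₁ X := by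
        rw [Finset.card_range]
        exact mul_le_mul_of_nonneg_left (Finset.sum_le_sum fun i hi =>
          sq_le_locProfMass hQ' τ (hzQ i (Finset.mem_range.1 hi).le) (hzd i (Finset.mem_range.1 hi).le)) (Nat.cast_nonneg _)
    _ = (k : ℝ) * (k : ℝ) * locProfMass S Ψ a b w hQ' τ r₁ X := by rw [Finset.sum_const, Finset.card_range, nsmul_eq_mul]; ring
    _ ≤ (6 * C₁ + 8) * (6 * C₁ + 8) * locProfMass S Ψ a b w hQ' τ r₁ X :=
        mul_le_mul_of_nonneg_right (mul_le_mul hkK hkK (Nat.cast_nonneg _) (by positivity)) hM0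
    _ = (6 * C₁ + 8) ^ 2 * locProfMass S Ψ a b w hQ' τ r₁ X := by ring

/-- unit index neighbourhoods have `≤ 27` sites. [formal bookkeeping] -/
theorem card_filter_dist_le_one (B : Finset (Cell 2 × ℤ)) (X : Cell 2 × ℤ) : ((B.filter fun Y => dist X Y ≤ 1).card : ℝ) ≤ 27 := by
  have hsub : (B.filter fun Y => dist X Y ≤ 1) ⊆ idxBallF X 1 := fun Y hY => by
    rw [mem_idxBallF, dist_comm]
    exact (Finset.mem_filter.1 hY).2
  have h := Finset.card_le_card hsub
  rw [card_idxBallF_eq X zero_le_one, Nat.floor_one] at h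
  exact_mod_cast h

/-- COUNTING ATOMS ABOUT A SITE through the injective atom map: `#{X ∈ B : dist z (atomOf X) ≤ r₁} ≤ (2(r₁+1)/δ+1)³`. [formal bookkeeping] -/
theorem card_filter_atomOf_near_le (hbij : BijOn Ψ S (Layered a b w)) (hc : 0 < c) (hcr : IsLayeredCrystal c a b w) (hδ : 0 < δ) (hsep : IsSep δ S)
    (B : Finset (Cell 2 × ℤ)) (z : E3) {r₁ : ℝ} (hr₁ : 0 ≤ r₁) :
    ((B.filter fun X => dist z (atomOf S Ψ a b w X) ≤ r₁).card : ℝ) ≤ (2 * (r₁ + 1) / δ + 1) ^ 3 := by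
  have hfin : (S ∩ ball z (r₁ + 1)).Finite := finite_inter_ball_of_isSep hδ hsep z (r₁ + 1)
  have h1 : (B.filter fun X => dist z (atomOf S Ψ a b w X) ≤ r₁).card ≤ hfin.toFinset.card := by
    refine Finset.card_le_card_of_injOn (atomOf S Ψ a b w) (fun X hX => ?_) ((atomOf_injective hbij hc hcr).injOn)
    rw [Finset.mem_coe, Set.Finite.mem_toFinset]
    refine ⟨atomOf_mem hbij X, mem_ball.2 ?_⟩
    rw [dist_comm]
    linarith [(Finset.mem_filter.1 hX).2]
  have h2 := ncard_inter_ball_le_packing hδ hsep z (show (0 : ℝ) ≤ r₁ + 1 by linarith)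
  rw [Set.ncard_eq_toFinset_card _ hfin] at h2
  exact (show ((B.filter fun X => dist z (atomOf S Ψ a b w X) ≤ r₁).card : ℝ) ≤ (hfin.toFinset.card : ℝ) by exact_mod_cast h1).trans h2

/-- the Direction-B dictionary constant `27·(6C₁+8)²·(2((28/25)(6C₁+8)+1)/δ+1)³`. [this file, g59] -/
def dictB (C₁ δ : ℝ) : ℝ := 27 * (6 * C₁ + 8) ^ 2 * (2 * (28 / 25 * (6 * C₁ + 8) + 1) / δ + 1) ^ 3

/-- ★★ **DIRECTION B OF THE ENERGY DICTIONARY (top scale)**: if the displacement `id − Ψ` of a bijective bond isomorphism onto a clean `C₁`-tame co-Lipschitz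
crystal is DOMINATED ON BONDS by a profile `τ ≥ 0` on a finite region `Q' ⊆ S` containing the `(28/25)(6C₁+8)`-neighbourhoods of the atoms of `idxBall X₀ n`,
then `idxEnergy (pullDisp S Ψ a b w) (idxBall X₀ n) ≤ dictB C₁ δ · Σ_{Q'} τ²` (per unit bond XG.3's chain bound; `≤ 27` neighbours; exchange of summation and
the packing count of atoms about a site). [this file, g59] -/
theorem idxEnergy_pullDisp_le_profile (hbij : BijOn Ψ S (Layered a b w)) (hiso : IsBondIso S Ψ) (hH : IsClean (μS (Layered a b w)))
    (hT : IsTameIndexing C₁ a b w) (hc : 0 < c) (hcr : IsLayeredCrystal c a b w) (hδ : 0 < δ) (hsep : IsSep δ S)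
    {Q' : Set E3} (hQ' : Q'.Finite) {τ : E3 → ℝ}
    (hdom : ∀ x ∈ Q', ∀ p ∈ Q', dist p x ≤ 4 → ‖(p - Ψ p) - (x - Ψ x)‖ ≤ τ x) (hτ : ∀ x ∈ Q', 0 ≤ τ x) (X₀ : Cell 2 × ℤ) (n : ℝ)
    (hK : ∀ X ∈ idxBall X₀ n, S ∩ closedBall (atomOf S Ψ a b w X) (28 / 25 * (6 * C₁ + 8)) ⊆ Q') :
    idxEnergy (pullDisp S Ψ a b w) (idxBall X₀ n) ≤ dictB C₁ δ * ∑ᶠ z ∈ Q', τ z ^ 2 := by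
  have hC : 0 ≤ C₁ := (norm_nonneg a).trans hT.1
  set r₁ : ℝ := 28 / 25 * (6 * C₁ + 8) with hr₁
  have hr₁0 : 0 ≤ r₁ := by positivity
  set B : Finset (Cell 2 × ℤ) := idxBallF X₀ n with hB
  set φ := pullDisp S Ψ a b w with hφ
  set T : Cell 2 × ℤ → ℝ := locProfMass S Ψ a b w hQ' τ r₁ with hTd
  have hT0 : ∀ X, 0 ≤ T X := fun X => locProfMass_nonneg hQ' τ r₁ X
  have hBmem : ∀ X ∈ B, X ∈ idxBall X₀ n := fun X hX => by rw [hB, mem_idxBallF] at hX; exact hX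
  -- (1) per pair and the 27 neighbours
  have h1 : idxEnergy φ (idxBall X₀ n) ≤ ∑ X ∈ B, 27 * ((6 * C₁ + 8) ^ 2 * T X) := by
    rw [← coe_idxBallF, idxEnergy_coe_finset]
    calc ∑ x ∈ (B ×ˢ B).filter (fun x => dist x.1 x.2 ≤ 1), ‖φ x.2.1 x.2.2 - φ x.1.1 x.1.2‖ ^ 2
        ≤ ∑ x ∈ (B ×ˢ B).filter (fun x => dist x.1 x.2 ≤ 1), (6 * C₁ + 8) ^ 2 * T x.1 := Finset.sum_le_sum fun x hx => by
          obtain ⟨hxB, hd⟩ := Finset.mem_filter.1 hx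
          obtain ⟨h1B, -⟩ := Finset.mem_product.1 hxB
          exact norm_pullDisp_sub_sq_le_locProfMass hbij hiso hH hT hQ' hdom hτ hd (hK _ (hBmem _ h1B))
      _ = ∑ X ∈ B, ∑ Y ∈ B, if dist X Y ≤ 1 then (6 * C₁ + 8) ^ 2 * T X else 0 := by
          rw [Finset.sum_filter, Finset.sum_product]
      _ = ∑ X ∈ B, ((B.filter fun Y => dist X Y ≤ 1).card : ℝ) * ((6 * C₁ + 8) ^ 2 * T X) := by
          refine Finset.sum_congr rfl fun X _ => ?_
          rw [← Finset.sum_filter, Finset.sum_const, nsmul_eq_mul]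
      _ ≤ ∑ X ∈ B, 27 * ((6 * C₁ + 8) ^ 2 * T X) := Finset.sum_le_sum fun X _ =>
          mul_le_mul_of_nonneg_right (card_filter_dist_le_one B X) (mul_nonneg (sq_nonneg _) (hT0 X))
  -- (2) exchange of summation and the packing count
  have h2 : ∑ X ∈ B, T X ≤ (2 * (r₁ + 1) / δ + 1) ^ 3 * ∑ z ∈ hQ'.toFinset, τ z ^ 2 := by
    calc ∑ X ∈ B, T X = ∑ z ∈ hQ'.toFinset, ∑ X ∈ B, (if dist z (atomOf S Ψ a b w X) ≤ r₁ then τ z ^ 2 else 0) := by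
          rw [Finset.sum_comm]; rfl
      _ = ∑ z ∈ hQ'.toFinset, ((B.filter fun X => dist z (atomOf S Ψ a b w X) ≤ r₁).card : ℝ) * τ z ^ 2 := by
          refine Finset.sum_congr rfl fun z _ => ?_
          rw [← Finset.sum_filter, Finset.sum_const, nsmul_eq_mul]
      _ ≤ ∑ z ∈ hQ'.toFinset, (2 * (r₁ + 1) / δ + 1) ^ 3 * τ z ^ 2 := Finset.sum_le_sum fun z _ =>
          mul_le_mul_of_nonneg_right (card_filter_atomOf_near_le hbij hc hcr hδ hsep B z hr₁0) (sq_nonneg _)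
      _ = (2 * (r₁ + 1) / δ + 1) ^ 3 * ∑ z ∈ hQ'.toFinset, τ z ^ 2 := by rw [Finset.mul_sum]
  -- (3) assemble
  have hsum0 : 0 ≤ ∑ z ∈ hQ'.toFinset, τ z ^ 2 := Finset.sum_nonneg fun z _ => sq_nonneg _
  rw [finsum_mem_eq_finite_toFinset_sum _ hQ']
  calc idxEnergy φ (idxBall X₀ n) ≤ ∑ X ∈ B, 27 * ((6 * C₁ + 8) ^ 2 * T X) := h1
    _ = 27 * (6 * C₁ + 8) ^ 2 * ∑ X ∈ B, T X := by rw [Finset.mul_sum]; exact Finset.sum_congr rfl fun X _ => by ring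
    _ ≤ 27 * (6 * C₁ + 8) ^ 2 * ((2 * (r₁ + 1) / δ + 1) ^ 3 * ∑ z ∈ hQ'.toFinset, τ z ^ 2) := mul_le_mul_of_nonneg_left h2 (by positivity)
    _ = dictB C₁ δ * ∑ z ∈ hQ'.toFinset, τ z ^ 2 := by rw [dictB, hr₁]; ring

/-- ★ **THE TOP-SCALE INDEX ENERGY FROM REGISTRATION DATA**: `IsRegistered κ 4 ρ S Q' H Ψ τ` (part Q: bond domination, `τ ≥ 0`, `Σ τ² ≤ κ·nK Q'`) on a region
containing the neighbourhoods of the atoms of `idxBall X₀ n` gives `idxEnergy (pullDisp S Ψ a b w) (idxBall X₀ n) ≤ dictB C₁ δ · κ · nK Q'` — with `IsGlobalReg`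
(`κ = Cg(D/R)η`, `Q' = win D`) the `C₀·η` of the memo's budget closing. [this file, g59] -/
theorem idxEnergy_pullDisp_le_of_isRegistered (hbij : BijOn Ψ S (Layered a b w)) (hiso : IsBondIso S Ψ) (hH : IsClean (μS (Layered a b w)))
    (hT : IsTameIndexing C₁ a b w) (hc : 0 < c) (hcr : IsLayeredCrystal c a b w) (hδ : 0 < δ) (hsep : IsSep δ S)
    {Q' H : Set E3} (hQ' : Q'.Finite) {κ ρ : ℝ} {τ : E3 → ℝ} (hreg : IsRegistered κ 4 ρ S Q' H Ψ τ) (X₀ : Cell 2 × ℤ) (n : ℝ)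
    (hK : ∀ X ∈ idxBall X₀ n, S ∩ closedBall (atomOf S Ψ a b w X) (28 / 25 * (6 * C₁ + 8)) ⊆ Q') :
    idxEnergy (pullDisp S Ψ a b w) (idxBall X₀ n) ≤ dictB C₁ δ * (κ * nK Q') := by
  obtain ⟨-, -, hτE, hdom, hsum, -⟩ := hreg
  have h := idxEnergy_pullDisp_le_profile hbij hiso hH hT hc hcr hδ hsep hQ' (τ := τ) (fun x hx p hp hd => by
    have h := hdom x hx p hp hd
    rw [dist_eq_norm] at h
    have e : p - Ψ p - (x - Ψ x) = p - x - (Ψ p - Ψ x) := by abel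
    rwa [e]) (fun x hx => (hτE x hx).1) X₀ n hK
  have hB0 : 0 ≤ dictB C₁ δ := by
    have hC : 0 ≤ C₁ := (norm_nonneg a).trans hT.1
    unfold dictB; positivity
  exact h.trans (mul_le_mul_of_nonneg_left hsum hB0)

end DirectionB

end Summit.AtomisticToContinuum.Crystallization.Theorems.ChartedZeroExcessLayeredLatticeLiouville

end
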